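import Summits.QuantumFields.BalabanUV.T4Continuum.Support.NE9LinSizeEndCPiece
import Summits.QuantumFields.BalabanUV.T4Continuum.Support.NE9LinSizeEndMultiScaleBudget

/-!
# NE9LinSizeEndPrintShaped — N2-septies: the leaf-01 budget made SPECIES-, DATUM- and CHART-AGNOSTIC — the ROOT d-currency torus
END E5′ (`NE9LinSizeEnd.torus_termSize_ne9_and_fadingMemory_of_linSizeDischargers`, p209889: abstract channel `T`, any torus cube
chart `Γ` on any carriers `C`) and the class-relative piece-form END E5′-πG-CL (`NE9LinSizeEndCPiece.…_cpieceGain`, p212669: any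
`P : CPieceData C …`, any class `Adm`, any gain) IN PRINT-SHAPED LETTERS — cell `pub-balaban`, T4-DAG §2 node U3 / §6 NE9; rung (B)+1
on a FIXED finite T⁴; own-initiative lineage census item of unit `b2b-balaban-t4-ne9-formalise-leaf-01` (gen 6; journal CLAIM
l.9910), the seventh of the N2 series (N2-bis p208845 ∣ N2-ter p209831 / p210131 / p210458 ∣ N2-quater p211624 ∣ N2-quinquies p212549 ∣
N2-sexies p213373 / p213554); composition BY NAME, nothing of p209889 / p212669 / p211624 is modified, no END re-wired.

HONEST FRAMING (T4-DAG PAGE 1).  Rung (B)+1 = existence and uniqueness of the ε → 0 limit of gauge-invariant observables on a FIXED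
finite torus T⁴ — NOT infinite volume, NOT a mass gap, NOT the Clay problem.  NE9 (`T4OutputRate.NE9` ∧ `FadingMemory`) is a cell
NEW ESTIMATE, NOT PRINTED and NOT discharged here («NE9 ⇐ the named binders»).  What this file does is BOOKKEEPING: it CHOOSES the
two scalars `a₁` (KP size constant) and `lip k = lipbar` (outer Lipschitz letter) of the two most generic d-currency END faces in the
tree so that their exponential-carrying binders are discharged from ONE exponential smallness and ONE additive rate condition, and
rewrites the rate letter into its POLYNOMIAL form.  Every analytic input stays a DISPLAYED binder — (A″) the (2.38)-TYPE decay of the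
box majorant in `d_k`, (L‴) the (2.20)-TYPE decay of the coefficient tables, the recursion side (`Factorises`, `LastCouplingLipschitz`,
S1/S2 and, in §1, S3/S4/S5; in §2 the class-relative piece binders `PieceZero` / `PieceLocal` / `CSrcScale` / `PieceAdditiveOn Adm` /
`PieceBoundOnG Adm` and the level counts `LevelCountsG`), the geometry (`hXconn`, `hcmp`).  0 `def`, 0 `sorry`; [I]/[II] locators are
TYPE locators (ABSOLUTE RULE: nothing printed is a hypothesis-free assertion here); `FlowStep.BetaPertH`, (B), (B^μ) do not occur.
HONEST DEPENDENCY (cell line, verbatim): continuum YM on T⁴ ⇐ BetaPertH ∧ nine spine estimates (0/9 proved); BetaPertH ⇐ (D1) ∧ (D4)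
∧ CAP+tail; G-an2-4 gates asym, D1 and NE2/3/4.

WHY (journal l.9910).  The located findings O-ne9p1g22-1 → g23-1 → g24-1 → g25-1 each RE-TYPED the displayed species' datum (gen 25:
the curve species `CurData`) and F-ne9leaf07g5-1 adds a chart re-typing (`dblChart Γ` on the doubled carriers); the N2 series so far
priced each END face AS IT CAME (E5′-ms, TR, E5′-REM).  But the print-shaped step never READS the species, the datum or the chart: it
acts on the ROOT.  So it is done here ONCE at the root (§1) and once at the class-relative piece form (§2); every species / datum /
chart face (N2-sexies p213373 §2 for the ray datum; the curve-datum and doubled-chart twins of crew row (w21)) is then ONE `exact` of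
§2 (resp. §1) with the producers of that species fed BY NAME — kernel-checked for the ray datum in the lineage's probe
`HOME/t4/b2b-balaban-t4-ne9-formalise-leaf-01/g6/ProbePrintShapedInstances.lean`, not in this file (no datum occurs here).

WHAT IS PROVED (kernel).
§1 **`torus_termSize_ne9_and_fadingMemory_printShaped`** — ROOT E5′ (p209889) with `a₁ := a₁⋆ = 2e(D+1)·2^(2^ν)·2^(ν+1+2^ν)·ε̄·
   e^{a″(ν+1)}`, `lip k = lipbar := ᾱ·2^(ν+1+2^ν)` CHOSEN: the letters `a₁ lip lipbar` and the binders `ha₁ hlip hlipb hliplb hsmall hrate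
   hpos` are GONE; DISPLAYED instead the sup letters `hε'b : ε′ k ≤ ε̄`, `hα4b : α4 k ≤ ᾱ`, `hαbar : 0 < ᾱ`, the ONE exponential
   smallness **`hKP : 2^(ν+1)·e·(D+1)·2^(2^ν)·2^(ν+1+2^ν)·ε̄·e^{a″(ν+1)} ≤ 1`** (TYPE [II] p. 18 «exp C₂κ₁ exp 5κ ≤ 1», ν + 1 = 5), the
   ADDITIVE letter-free rate condition **`hrate : a″ + 1 + 2^(ν+1)·log 2 + log(8ν) ≤ a′`**, `hω : 0 < ω`, and (N) with the
   exponential-free increment **`p₀ j + 2e(D+1)·2^(2^ν)·2^(ν+1+2^ν)·ε̄ ≤ N (j+1)`** (TYPE p. 21 «O(1)C₃ε₁ ≦ ½E₀»); every other binder of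
   p209889 VERBATIM (abstract channel `T` with S3 `hadd` / S4 `hsum` / S5 `hstep` displayed, profile `τ k j ≤ τ̄·ω^(k−j)`).
   Conclusion: `TermSize E W κ N` and the END with the POLYNOMIAL rate letter **`μ⋆ = ω + 8e(D+1)·2^(2^ν)·(2^(ν+1+2^ν))²·ᾱ·ε̄·τ̄`**.
§2 **`torus_termSize_ne9_and_fadingMemory_cpieceGain_printShaped`** — E5′-πG-CL (p212669 §1) likewise: ANY class-relative piece form
   `P : CPieceData C Bg ι αi βi γi`, ANY class `Adm`, ANY gain; `T := cpieceChannel P`, `wt := weightOf P.frame κ₁ d₀ O1 Kp`,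
   `τ := tauOfG c_Q (agePow ω)` so **`τ̄ = c_Q`** (print: (6L)⁴): rate letter **`μ⋆ = ω + 8e(D+1)·2^(2^ν)·(2^(ν+1+2^ν))²·ᾱ·ε̄·c_Q`**.
   N2-sexies p213373 §2 is §2 at `C := doubleCarriers C₀`, `P := Dd.toC`, `Adm := analyticClass Dd.R`, `Kp := KpOf Dd c_dir`,
   `gain := ℓ⁵` with `hres h0P hloc hsrc hPiece hKp hgain` fed by the ray-datum producers — token for token (probe).
BUDGET (unchanged letters, read off once; `NE9LinSizeEndBudget` / `NE9LinSizeEndMultiScaleBudget` §3 / `NE9LinSizeEndRemSpeciesBudget`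
§1, §3 apply verbatim): fading `μ⋆ < 1` ⇔ `8e(D+1)·2^(2^ν)·(2^(ν+1+2^ν))²·ᾱ·ε̄·τ̄ < 1 − ω` (T⁴, ν = 4: `72e·2^58·(D+1)/9·ᾱ·ε̄·τ̄ < 1 − ω`
at D + 1 = 9); under `hKP` the gap is `≤ 2^(3+2^ν)·ᾱ·τ̄·e^{−a″(ν+1)}` (`rateGap_le_of_KP` with `c_Q ↦ τ̄`).  No new arithmetic here.
DISGUISE TEST: two END faces APPLIED BY NAME with two real scalars instantiated; asserts nothing about Bałaban's 𝐇_k, 𝔘^c_j, (1.23),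
(1.33) or O1; S5 remains the fading SOURCE (displayed), NE9's two-history content is the END's, unchanged.

References (TYPE locators only; nothing printed is a hypothesis): T. Bałaban, CMP **116** (1988) [Balaban1988RG2Cluster] (1.23)–(1.29)
pp. 7–8, (1.36) p. 9, (2.18)–(2.20) p. 16, (2.26)–(2.27) pp. 17–18, p. 18 text, (2.29)–(2.30) p. 18, Lemma 3 (2.38) p. 20, (2.40)–(2.41)
p. 21 and p. 21 text; CMP **109** (1987) [Balaban1987RG1] (0.23) p. 256, p. 257, (0.29)–(0.30) p. 258, (1.18) p. 263, (3.54) p. 280;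
R. Kotecký, D. Preiss, CMP **103** (1986) [KoteckyPreiss1986].
-/

noncomputable section

namespace Summit.QuantumFields.BalabanUV.T4Continuum.NE9LinSizeEndPrintShaped

open scoped BigOperators
open Metric Set MeasureTheory BoundedContinuousFunction
open Literature.Probability.LatticeModels
open Literature.MathematicalPhysics.QuantumFieldTheory
open Literature.MathematicalPhysics.QuantumFieldTheory.Balaban1983to89
open Literature.MathematicalPhysics.QuantumFieldTheory.Balaban1983to89.T4OutputRate
open Literature.MathematicalPhysics.QuantumFieldTheory.Balaban1983to89.T4ActivityLipschitz
open Literature.MathematicalPhysics.QuantumFieldTheory.Balaban1983to89.T4HistoryLipschitzRecursion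
open Literature.MathematicalPhysics.QuantumFieldTheory.Balaban1983to89.T4HistoryLipschitzOuter
open Literature.MathematicalPhysics.QuantumFieldTheory.Balaban1983to89.T4HistoryLipschitzActivity
open Literature.MathematicalPhysics.QuantumFieldTheory.Balaban1983to89.T4HistoryLipschitzEntropy
open Literature.MathematicalPhysics.QuantumFieldTheory.Balaban1983to89.T4HistoryLipschitzCubeGeometry
open Literature.MathematicalPhysics.QuantumFieldTheory.Balaban1983to89.T4HistoryLipschitzActivity (ClusterGeom)
open Literature.MathematicalPhysics.QuantumFieldTheory.Balaban1983to89.T4HistoryLipschitzSegment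
open Literature.MathematicalPhysics.QuantumFieldTheory.Balaban1983to89.T4HistoryLipschitzLinearSize
open Summit.QuantumFields.BalabanUV.T4Continuum.NE9Lemma1Counting
open Summit.QuantumFields.BalabanUV.T4Continuum.NE9Lemma1Gain
open Summit.QuantumFields.BalabanUV.T4Continuum.NE9Lemma1PieceClass
open Summit.QuantumFields.BalabanUV.T4Continuum.NE9LinSizeEnd
open Summit.QuantumFields.BalabanUV.T4Continuum.NE9LinSizeEndCPiece
open Summit.QuantumFields.BalabanUV.T4Continuum.NE9LinSizeEndMultiScaleBudget

variable {ν N : ℕ} {C : Carriers} {D : ℕ}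
variable {Bg : Type} {Sp : Type*} [TopologicalSpace Sp] [MeasurableSpace Sp] [OpensMeasurableSpace Sp] {F : Type*}
  [Fintype F] {Ω : Type*} [MeasurableSpace Ω]

/-! ## §1 ROOT E5′ IN PRINT-SHAPED LETTERS (abstract channel, any torus cube chart on any carriers) -/

section Root

/-- **ROOT E5′ IN PRINT-SHAPED LETTERS (kernel end-to-end).**  `NE9LinSizeEnd.torus_termSize_ne9_and_fadingMemory_of_linSizeDischargers`
(p209889: the d-currency torus END of row NE9 for an ABSTRACT linear channel `T` on the class `Adm` — S3 `hadd`, S4 `hsum`, S5 `hstep`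
DISPLAYED — on ANY torus cube chart `Γ : CubeChart C (Fin ν → ZMod N) (torusAdj ν N) D` over ANY carriers `C`) with its bookkeeping
scalars CHOSEN — `a₁ := a₁⋆ = 2e(D+1)·2^(2^ν)·2^(ν+1+2^ν)·ε̄·e^{a″(ν+1)}`, `lip k = lipbar := ᾱ·2^(ν+1+2^ν)` — so that the letters
`a₁ lip lipbar` and the binders `ha₁ hlip hlipb hliplb hsmall hrate hpos` are GONE; DISPLAYED instead: the sup letters `hε'b : ε′ k ≤ ε̄`,
`hα4b : α4 k ≤ ᾱ`, `hαbar : 0 < ᾱ`, the ONE exponential smallness **`hKP : 2^(ν+1)·e·(D+1)·2^(2^ν)·2^(ν+1+2^ν)·ε̄·e^{a″(ν+1)} ≤ 1`**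
(TYPE [II] p. 18 «exp C₂κ₁ exp 5κ ≤ 1», `ν + 1 = 5`), the ADDITIVE letter-free rate condition **`hrate : a″ + 1 + 2^(ν+1)·log 2 +
log(8ν) ≤ a′`**, `hω : 0 < ω`, and (N) with the exponential-free increment **`hNsucc : p₀ j + 2e(D+1)·2^(2^ν)·2^(ν+1+2^ν)·ε̄ ≤ N (j+1)`**
(TYPE p. 21 «O(1)C₃ε₁ ≦ ½E₀»); every other binder of p209889 VERBATIM (recursion side, (B0)/(X)/(R′), regularity, `hmeet`, (lip) `ha`,
(L‴) `hlin`/`hdomconn`/`hdominj`, geometry `hXconn`/`hcmp`, (A″) `hdecayLin` in `d_k`, `ha″`, `hℓ hτbar hlam hτ`).  Conclusion: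
`TermSize E W κ N` and the END with the POLYNOMIAL rate letter **`μ⋆ = ω + 8e(D+1)·2^(2^ν)·(2^(ν+1+2^ν))²·ᾱ·ε̄·τ̄`** — no `e^{a}`,
`e^{a′}`, `e^{a″}`, `e^{κ}` anywhere in the face (F-ne9leaf01-1 (R)(P) repaired at the ROOT).  Composition BY NAME: p209889 ∘ N2-quater
§1 (`smallness_of_printShaped`, `rate_of_printShaped`, `aStar_envelope`, `rateLetter_printShaped` with `Dp := D + 1`).  (A″)/(L‴)/the
recursion side DISPLAYED, nothing of [I]/[II] asserted; rung (B)+1 bookkeeping on a finite torus.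
[cite: Balaban1988RG2Cluster, p.18 text, (2.26)-(2.27) pp.17-18, (2.29)-(2.30) p.18, Lemma 3 (2.38) p.20, (2.40)-(2.41) p.21 and p.21 text, (1.26) p.8, (1.36) p.9, (2.18)-(2.20) p.16; Balaban1987RG1, (0.23) p.256, p.257, (1.18) p.263; KoteckyPreiss1986, (1)-(3)] -/
theorem torus_termSize_ne9_and_fadingMemory_printShaped (Γ : CubeChart C (Fin ν → ZMod N) (torusAdj ν N) D)
    {ι : Type} {E : Functional C Bg}
    {W : Set (ℕ → ℝ)} {Adm : Set (Bg → C.Dom → ℝ)} {T : ℕ → (ℕ → ℝ) → (Bg → C.Dom → ℝ) → ι → ℝ}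
    {Ψ : ℕ → ℝ → (ι → ℝ) → Bg → C.Dom → ℝ}
    {μ : ℕ → ℝ → Bg → Finset (Fin ν → ZMod N) → Measure Ω} {pre : ℕ → ℝ → Bg → Finset (Fin ν → ZMod N) → Ω → ℂ}
    {c : ℕ → ℝ → Bg → Finset (Fin ν → ZMod N) → Ω → F → ℂ}
    {pt : ℕ → ℝ → Bg → Finset (Fin ν → ZMod N) → Ω → F → Sp} {β : ℕ → Sp → ℝ}
    {dom : ℕ → Finset (Fin ν → ZMod N) → F → Finset (Fin ν → ZMod N)}
    {ε' α4 : ℕ → ℝ} {a'' κ ℓ τbar ω a a' εbar αbar : ℝ} {wt : ℕ → ι → ℝ} {τ : ℕ → ℕ → ℝ} {lam p₀ Nsz : ℕ → ℝ}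
    (ρ : ℕ → (ι → ℝ) → (Sp →ᵇ ℂ))
    -- recursion side (displayed, named binders of the P2 leaves)
    (h0 : ScaleZeroFree E W) (hAdm : AdmissibleTerms E W Adm) (hres : AdmRestrict Adm)
    (hadd : ChannelAdditive Adm T) (hsum : ChannelStepSum Adm T) (hstep : ChannelSizeAtStepNN Adm T κ wt τ)
    (hfac : Factorises E W T Ψ) (hlast : LastCouplingLipschitz E W T Ψ κ lam)
    (hρ : ∀ (k : ℕ) (P P' : ι → ℝ) (M : ℝ), (∀ y, |P y - P' y| ≤ wt k y * M) → ‖ρ k P - ρ k P'‖ ≤ M)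
    (hΨ : ∀ (k : ℕ) (s : ℝ) (P P' : ι → ℝ) (U : Bg) (X : C.Dom),
      Ψ k s P U X - Ψ k s P' U X =
        (Γ.geom.newTerm (Γ.geom.avgExpLinearAct μ pre fun k s U γ ω => evalFunctional (c k s U γ ω) (pt k s U γ ω))
            k s U X (ρ k P) -
          Γ.geom.newTerm (Γ.geom.avgExpLinearAct μ pre fun k s U γ ω => evalFunctional (c k s U γ ω) (pt k s U γ ω))
            k s U X (ρ k P')).re)
    -- the size-induction data (B0), (X), (N) with the EXPONENTIAL-FREE increment B = 2e(D+1)·2^(2^ν)·2^(ν+1+2^ν)·ε̄, (R′)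
    (hexpl : ∀ g ∈ W, ∀ (k : ℕ) (P : ι → ℝ) (U : Bg) (X : C.Dom), C.scale X = k + 1 →
      |Ψ k (g k) P U X -
          (Γ.geom.newTerm (Γ.geom.avgExpLinearAct μ pre fun k s U γ ω => evalFunctional (c k s U γ ω) (pt k s U γ ω))
            k (g k) U X (ρ k P)).re| ≤ Real.exp (-(κ * C.d X)) * p₀ k)
    (hbase : ∀ g ∈ W, ∀ (U : Bg) (X : C.Dom), C.scale X = 0 → |E g U X| ≤ Real.exp (-(κ * C.d X)) * Nsz 0)
    (hNsucc : ∀ j, p₀ j + 2 * Real.exp 1 * ((D : ℝ) + 1) * (2:ℝ) ^ (2 ^ ν) * 2 ^ (ν + 1 + 2 ^ ν) * εbar ≤ Nsz (j + 1))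
    (hNnn : ∀ j, 0 ≤ Nsz j)
    (hbox : ∀ (k : ℕ) (P : ι → ℝ), (∀ y, |P y| ≤ wt k y * sizeRadius τ Nsz k) → ∀ x, ‖ρ k P x‖ ≤ β k x)
    -- activity side: regularity data, ONE integrability, support of the coefficients
    (hpre : ∀ k s U γ, AEStronglyMeasurable (pre k s U γ) (μ k s U γ))
    (hc : ∀ k s U γ Y, AEStronglyMeasurable (fun ω => c k s U γ ω Y) (μ k s U γ))
    (hpt : ∀ k s U γ Y, Measurable fun ω => pt k s U γ ω Y)
    (hint₀ : ∀ k s U γ, Integrable (fun ω => ‖pre k s U γ ω‖ * Real.exp (boxExponent c pt β k s U γ ω)) (μ k s U γ))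
    (hmeet : ∀ k s U (γ : Finset (Fin ν → ZMod N)) ω Y, c k s U γ ω Y ≠ 0 → ∃ x ∈ γ, x ∈ dom k γ Y)
    -- (L‴) decay of the coefficient tables in d_k with a SUP LETTER ᾱ for their scale (TYPE (2.20): α₄ is one constant)
    (hα4 : ∀ k, 0 ≤ α4 k) (hα4b : ∀ k, α4 k ≤ αbar) (hαbar : 0 < αbar)
    (ha : (2:ℝ) ^ ν * Real.log 2 + Real.log (8 * ν) ≤ a)
    (hlin : ∀ k s U (γ : Finset (Fin ν → ZMod N)) ω Y,
      ‖c k s U γ ω Y‖ ≤ α4 k * Real.exp (-(a * (linSize (dom k γ Y) : ℝ))))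
    (hdomconn : ∀ k (γ : Finset (Fin ν → ZMod N)) Y, (dom k γ Y).Nonempty →
      ∃ b ∈ dom k γ Y, Polymer.IsConn (torusAdj ν N) (dom k γ Y) b)
    (hdominj : ∀ k (γ : Finset (Fin ν → ZMod N)), Set.InjOn (dom k γ) {Y | (dom k γ Y).Nonempty})
    -- the d-currency geometry: wall-connected domain cubes ([I] p.257), comparability `κ·C.d X ≤ a″·d(cubes X)`
    (hXconn : ∀ X, ∃ b, Polymer.IsConn (torusAdj ν N) (Γ.cubes X) b)
    (hcmp : ∀ X, κ * C.d X ≤ a'' * (linSize (Γ.cubes X) : ℝ))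
    -- (A″) decay of the box majorant in d_k (TYPE (2.38)) with a SUP LETTER ε̄ for its scale (ε₁ is one constant)
    (hε' : ∀ k, 0 ≤ ε' k) (hε'b : ∀ k, ε' k ≤ εbar)
    (hdecayLin : ∀ g ∈ W, ∀ (k : ℕ) (U : Bg) (X : C.Dom), C.scale X = k + 1 → ∀ γ' ∈ Γ.vol X,
      ∫ ω, ‖pre k (g k) U γ' ω‖ * Real.exp (boxExponent c pt β k (g k) U γ' ω) ∂(μ k (g k) U γ') ≤
        ε' k * Real.exp (-(a' * (linSize γ' : ℝ))))
    (ha'' : 0 ≤ a'')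
    -- THE PRINT-SHAPED SCALARS: the one exponential smallness (TYPE p.18 «exp 5κ ≤ 1») and the ADDITIVE letter-free rate condition
    (hKP : 2 ^ (ν + 1) * Real.exp 1 * ((D : ℝ) + 1) * (2:ℝ) ^ (2 ^ ν) * 2 ^ (ν + 1 + 2 ^ ν) * εbar *
      Real.exp (a'' * (ν + 1)) ≤ 1)
    (hrate : a'' + 1 + 2 ^ (ν + 1) * Real.log 2 + Real.log (8 * ν) ≤ a')
    -- envelope data (`ω` a LETTER; instantiate `ω := L^{−α}`)
    (hℓ : 0 ≤ ℓ) (hτbar : 0 ≤ τbar) (hω : 0 < ω)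
    (hlam : ∀ k, lam k ≤ ℓ) (hτ : ∀ k j, j ≤ k → 0 ≤ τ k j ∧ τ k j ≤ τbar * ω ^ (k - j)) :
    TermSize E W κ Nsz ∧
      NE9 E W κ (prodModuli ℓ fun _ =>
        ω + 8 * Real.exp 1 * ((D : ℝ) + 1) * (2:ℝ) ^ (2 ^ ν) * (2 ^ (ν + 1 + 2 ^ ν)) ^ 2 * αbar * εbar * τbar) ∧
        FadingMemory
          (ℓ / (ω + 8 * Real.exp 1 * ((D : ℝ) + 1) * (2:ℝ) ^ (2 ^ ν) * (2 ^ (ν + 1 + 2 ^ ν)) ^ 2 * αbar * εbar * τbar))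
          (ω + 8 * Real.exp 1 * ((D : ℝ) + 1) * (2:ℝ) ^ (2 ^ ν) * (2 ^ (ν + 1 + 2 ^ ν)) ^ 2 * αbar * εbar * τbar)
          (prodModuli ℓ fun _ =>
            ω + 8 * Real.exp 1 * ((D : ℝ) + 1) * (2:ℝ) ^ (2 ^ ν) * (2 ^ (ν + 1 + 2 ^ ν)) ^ 2 * αbar * εbar * τbar) := by
  have hDp : (0:ℝ) ≤ (D : ℝ) + 1 := by positivity
  have hεbar : 0 ≤ εbar := (hε' 0).trans (hε'b 0)
  have hP0 : (0:ℝ) < 2 ^ (ν + 1 + 2 ^ ν) := by positivity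
  -- the chosen KP size constant `a₁⋆` and its discharged binders (N2-quater §1 BY NAME, `Dp := D + 1`)
  have hA0 : 0 ≤ 2 * Real.exp 1 * ((D : ℝ) + 1) * (2:ℝ) ^ (2 ^ ν) * 2 ^ (ν + 1 + 2 ^ ν) * εbar *
      Real.exp (a'' * (ν + 1)) := by positivity
  have hsmall := fun k => smallness_of_printShaped (ν := ν) hDp (hε' k) (hε'b k) hKP
  have hrate' := rate_of_printShaped (ν := ν) hKP hrate
  have eμ := rateLetter_printShaped ν ((D : ℝ) + 1) a'' εbar αbar τbar ω
  have hpos : 0 < ω + 4 * (αbar * 2 ^ (ν + 1 + 2 ^ ν)) *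
      (2 * Real.exp 1 * ((D : ℝ) + 1) * (2:ℝ) ^ (2 ^ ν) * 2 ^ (ν + 1 + 2 ^ ν) * εbar *
        Real.exp (a'' * (ν + 1)) * Real.exp (-(a'' * (ν + 1)))) * τbar := by
    rw [eμ]
    have : 0 ≤ 8 * Real.exp 1 * ((D : ℝ) + 1) * (2:ℝ) ^ (2 ^ ν) * (2 ^ (ν + 1 + 2 ^ ν)) ^ 2 * αbar * εbar * τbar := by
      have := hαbar.le
      positivity
    linarith
  have h := torus_termSize_ne9_and_fadingMemory_of_linSizeDischargers Γ ρ h0 hAdm hres hadd hsum hstep hfac hlast hρ hΨ hexpl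
    hbase (fun j => by rw [aStar_envelope]; exact hNsucc j) hNnn hbox hpre hc hpt
    (lip := fun _ => αbar * 2 ^ (ν + 1 + 2 ^ ν)) (lipbar := αbar * 2 ^ (ν + 1 + 2 ^ ν))
    (fun _ => mul_pos hαbar hP0) (fun _ => le_rfl) hint₀ hmeet hα4 ha
    (fun k => mul_le_mul_of_nonneg_right (hα4b k) hP0.le) hlin hdomconn hdominj hXconn hcmp hε' hdecayLin hA0 ha'' hrate'
    hsmall hℓ hτbar hω.le hpos hlam hτ
  rw [eμ] at h
  exact h

end Root

/-! ## §2 E5′-πG-CL IN PRINT-SHAPED LETTERS (any class-relative piece form, any class, any gain, any carriers) -/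

section PieceForm

/-- **E5′-πG-CL IN PRINT-SHAPED LETTERS (kernel end-to-end).**  `NE9LinSizeEndCPiece.torus_termSize_ne9_and_fadingMemory_of_linSizeDischargers_cpieceGain`
(p212669 §1: E5′ at `T := cpieceChannel P` for ANY class-relative piece form `P : CPieceData C Bg ι αi βi γi` on ANY carriers, ANY
class `Adm`, ANY gain; S3/S5 ON THE CLASS from the DISPLAYED piece binders `PieceZero` / `PieceLocal` / `CSrcScale` /
`PieceAdditiveOn Adm` / **`PieceBoundOnG Adm`** and the level counts `LevelCountsG P.frame` — so `τ̄ = c_Q`) with its bookkeeping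
scalars CHOSEN as in §1 (`a₁ := a₁⋆`, `lip k = lipbar := ᾱ·2^(ν+1+2^ν)`): GONE `a₁ lip lipbar ha₁ hlip hlipb hliplb hsmall hrate`;
DISPLAYED `hε'b hα4b hαbar`, the ONE exponential smallness `hKP`, the ADDITIVE letter-free `hrate`, and (N) with the exponential-free
increment; every other binder of p212669 §1 VERBATIM.  Conclusion: `TermSize E W κ N` and the END with the POLYNOMIAL rate letter
**`μ⋆ = ω + 8e(D+1)·2^(2^ν)·(2^(ν+1+2^ν))²·ᾱ·ε̄·c_Q`**.  THE SPECIES FACES ARE INSTANCES: N2-sexies p213373 §2 (ray datum) is this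
theorem at `C := doubleCarriers C₀`, `P := Dd.toC`, `Adm := analyticClass Dd.R`, `Kp := KpOf Dd c_dir`, `gain := ℓ⁵` with
`hres h0P hloc hsrc hPiece hKp hgain` fed by `admRestrict_analyticClass` / `pieceZero_rem` / `pieceLocal_rem` / `csrcScale_rem` /
`pieceBoundOnG_rem` / `kpOf_nonneg` / `pow_nonneg` (one `exact`; the lineage's probe); the curve datum and the doubled chart likewise
with their own producers.  Composition BY NAME: p212669 §1 ∘ N2-quater §1.  Nothing of [I]/[II] asserted; rung (B)+1 bookkeeping.
[cite: Balaban1987RG1, (0.29)-(0.30) p.258, (3.54) p.280; Balaban1988RG2Cluster, (1.23)-(1.29) pp.7-8, (1.33) p.9, p.18 text, (2.27) p.18, (2.38) p.20, (2.41) p.21 and p.21 text; KoteckyPreiss1986, (1)-(3)] -/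
theorem torus_termSize_ne9_and_fadingMemory_cpieceGain_printShaped
    (Γ : CubeChart C (Fin ν → ZMod N) (torusAdj ν N) D) {ι αi βi γi : Type} (P : CPieceData C Bg ι αi βi γi)
    {E : Functional C Bg} {W : Set (ℕ → ℝ)} {Adm : Set (Bg → C.Dom → ℝ)} {Ψ : ℕ → ℝ → (ι → ℝ) → Bg → C.Dom → ℝ}
    {μ : ℕ → ℝ → Bg → Finset (Fin ν → ZMod N) → Measure Ω} {pre : ℕ → ℝ → Bg → Finset (Fin ν → ZMod N) → Ω → ℂ}
    {c : ℕ → ℝ → Bg → Finset (Fin ν → ZMod N) → Ω → F → ℂ}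
    {pt : ℕ → ℝ → Bg → Finset (Fin ν → ZMod N) → Ω → F → Sp} {β : ℕ → Sp → ℝ}
    {dom : ℕ → Finset (Fin ν → ZMod N) → F → Finset (Fin ν → ZMod N)}
    {ε' α4 : ℕ → ℝ} {a'' κ κ₁ d0 O1 cQ ω ℓ a a' εbar αbar : ℝ} {Kp : ℕ → ι → ℝ} {gain : ℕ → ℕ → ℝ}
    {lam p₀ Nsz : ℕ → ℝ}
    (ρ : ℕ → (ι → ℝ) → (Sp →ᵇ ℂ))
    (h0 : ScaleZeroFree E W) (hAdm : AdmissibleTerms E W Adm) (hres : AdmRestrict Adm)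
    -- the class-relative piece form with a general gain: structure binders, ONE per-piece bound ON THE CLASS, the level counts
    (h0P : PieceZero P) (hloc : PieceLocal P) (hsrc : CSrcScale P) (hA : PieceAdditiveOn Adm P)
    (hPiece : PieceBoundOnG Adm P κ κ₁ d0 Kp gain) (hLev : LevelCountsG P.frame κ κ₁ O1 cQ gain (agePow ω))
    (hKp : ∀ k y, 0 ≤ Kp k y) (hO1 : 0 ≤ O1) (hgain : ∀ k j, 0 ≤ gain k j) (hcQ : 0 ≤ cQ) (hω : 0 < ω)
    -- E5′'s remaining recursion-side binders at `T := cpieceChannel P`, `wt := weightOf P.frame …`, `τ := tauOfG cQ (agePow ω)`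
    (hfac : Factorises E W (cpieceChannel P) Ψ) (hlast : LastCouplingLipschitz E W (cpieceChannel P) Ψ κ lam)
    (hρ : ∀ (k : ℕ) (Q Q' : ι → ℝ) (M : ℝ), (∀ y, |Q y - Q' y| ≤ weightOf P.frame κ₁ d0 O1 Kp k y * M) →
      ‖ρ k Q - ρ k Q'‖ ≤ M)
    (hΨ : ∀ (k : ℕ) (s : ℝ) (Q Q' : ι → ℝ) (U : Bg) (X : C.Dom),
      Ψ k s Q U X - Ψ k s Q' U X =
        (Γ.geom.newTerm (Γ.geom.avgExpLinearAct μ pre fun k s U γ ω => evalFunctional (c k s U γ ω) (pt k s U γ ω))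
            k s U X (ρ k Q) -
          Γ.geom.newTerm (Γ.geom.avgExpLinearAct μ pre fun k s U γ ω => evalFunctional (c k s U γ ω) (pt k s U γ ω))
            k s U X (ρ k Q')).re)
    (hexpl : ∀ g ∈ W, ∀ (k : ℕ) (Q : ι → ℝ) (U : Bg) (X : C.Dom), C.scale X = k + 1 →
      |Ψ k (g k) Q U X -
          (Γ.geom.newTerm (Γ.geom.avgExpLinearAct μ pre fun k s U γ ω => evalFunctional (c k s U γ ω) (pt k s U γ ω))
            k (g k) U X (ρ k Q)).re| ≤ Real.exp (-(κ * C.d X)) * p₀ k)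
    (hbase : ∀ g ∈ W, ∀ (U : Bg) (X : C.Dom), C.scale X = 0 → |E g U X| ≤ Real.exp (-(κ * C.d X)) * Nsz 0)
    -- (N) with the EXPONENTIAL-FREE increment B = 2e(D+1)·2^(2^ν)·2^(ν+1+2^ν)·ε̄
    (hNsucc : ∀ j, p₀ j + 2 * Real.exp 1 * ((D : ℝ) + 1) * (2:ℝ) ^ (2 ^ ν) * 2 ^ (ν + 1 + 2 ^ ν) * εbar ≤ Nsz (j + 1))
    (hNnn : ∀ j, 0 ≤ Nsz j)
    (hbox : ∀ (k : ℕ) (Q : ι → ℝ),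
      (∀ y, |Q y| ≤ weightOf P.frame κ₁ d0 O1 Kp k y * sizeRadius (tauOfG cQ (agePow ω)) Nsz k) → ∀ x, ‖ρ k Q x‖ ≤ β k x)
    -- activity side: regularity data, ONE integrability, support of the coefficients (verbatim)
    (hpre : ∀ k s U γ, AEStronglyMeasurable (pre k s U γ) (μ k s U γ))
    (hc : ∀ k s U γ Y, AEStronglyMeasurable (fun ω => c k s U γ ω Y) (μ k s U γ))
    (hpt : ∀ k s U γ Y, Measurable fun ω => pt k s U γ ω Y)
    (hint₀ : ∀ k s U γ, Integrable (fun ω => ‖pre k s U γ ω‖ * Real.exp (boxExponent c pt β k s U γ ω)) (μ k s U γ))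
    (hmeet : ∀ k s U (γ : Finset (Fin ν → ZMod N)) ω Y, c k s U γ ω Y ≠ 0 → ∃ x ∈ γ, x ∈ dom k γ Y)
    -- (L‴) the coefficient tables with a SUP LETTER ᾱ for their scale (TYPE [II] (2.20): α₄ is one constant)
    (hα4 : ∀ k, 0 ≤ α4 k) (hα4b : ∀ k, α4 k ≤ αbar) (hαbar : 0 < αbar)
    (ha : (2:ℝ) ^ ν * Real.log 2 + Real.log (8 * ν) ≤ a)
    (hlin : ∀ k s U (γ : Finset (Fin ν → ZMod N)) ω Y,
      ‖c k s U γ ω Y‖ ≤ α4 k * Real.exp (-(a * (linSize (dom k γ Y) : ℝ))))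
    (hdomconn : ∀ k (γ : Finset (Fin ν → ZMod N)) Y, (dom k γ Y).Nonempty →
      ∃ b ∈ dom k γ Y, Polymer.IsConn (torusAdj ν N) (dom k γ Y) b)
    (hdominj : ∀ k (γ : Finset (Fin ν → ZMod N)), Set.InjOn (dom k γ) {Y | (dom k γ Y).Nonempty})
    (hXconn : ∀ X, ∃ b, Polymer.IsConn (torusAdj ν N) (Γ.cubes X) b)
    (hcmp : ∀ X, κ * C.d X ≤ a'' * (linSize (Γ.cubes X) : ℝ))
    -- (A″) the box majorant in d_k with a SUP LETTER ε̄ for its scale (ε₁ is one constant)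
    (hε' : ∀ k, 0 ≤ ε' k) (hε'b : ∀ k, ε' k ≤ εbar)
    (hdecayLin : ∀ g ∈ W, ∀ (k : ℕ) (U : Bg) (X : C.Dom), C.scale X = k + 1 → ∀ γ' ∈ Γ.vol X,
      ∫ ω, ‖pre k (g k) U γ' ω‖ * Real.exp (boxExponent c pt β k (g k) U γ' ω) ∂(μ k (g k) U γ') ≤
        ε' k * Real.exp (-(a' * (linSize γ' : ℝ))))
    (ha'' : 0 ≤ a'')
    -- THE PRINT-SHAPED SCALARS: the one exponential smallness and the ADDITIVE letter-free rate condition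
    (hKP : 2 ^ (ν + 1) * Real.exp 1 * ((D : ℝ) + 1) * (2:ℝ) ^ (2 ^ ν) * 2 ^ (ν + 1 + 2 ^ ν) * εbar *
      Real.exp (a'' * (ν + 1)) ≤ 1)
    (hrate : a'' + 1 + 2 ^ (ν + 1) * Real.log 2 + Real.log (8 * ν) ≤ a')
    (hℓ : 0 ≤ ℓ) (hlam : ∀ k, lam k ≤ ℓ) :
    TermSize E W κ Nsz ∧
      NE9 E W κ (prodModuli ℓ fun _ =>
        ω + 8 * Real.exp 1 * ((D : ℝ) + 1) * (2:ℝ) ^ (2 ^ ν) * (2 ^ (ν + 1 + 2 ^ ν)) ^ 2 * αbar * εbar * cQ) ∧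
        FadingMemory
          (ℓ / (ω + 8 * Real.exp 1 * ((D : ℝ) + 1) * (2:ℝ) ^ (2 ^ ν) * (2 ^ (ν + 1 + 2 ^ ν)) ^ 2 * αbar * εbar * cQ))
          (ω + 8 * Real.exp 1 * ((D : ℝ) + 1) * (2:ℝ) ^ (2 ^ ν) * (2 ^ (ν + 1 + 2 ^ ν)) ^ 2 * αbar * εbar * cQ)
          (prodModuli ℓ fun _ =>
            ω + 8 * Real.exp 1 * ((D : ℝ) + 1) * (2:ℝ) ^ (2 ^ ν) * (2 ^ (ν + 1 + 2 ^ ν)) ^ 2 * αbar * εbar * cQ) := by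
  have hDp : (0:ℝ) ≤ (D : ℝ) + 1 := by positivity
  have hεbar : 0 ≤ εbar := (hε' 0).trans (hε'b 0)
  have hP0 : (0:ℝ) < 2 ^ (ν + 1 + 2 ^ ν) := by positivity
  -- the chosen KP size constant `a₁⋆` and its discharged binders (N2-quater §1 BY NAME, `Dp := D + 1`)
  have hA0 : 0 ≤ 2 * Real.exp 1 * ((D : ℝ) + 1) * (2:ℝ) ^ (2 ^ ν) * 2 ^ (ν + 1 + 2 ^ ν) * εbar *
      Real.exp (a'' * (ν + 1)) := by positivity
  have hsmall := fun k => smallness_of_printShaped (ν := ν) hDp (hε' k) (hε'b k) hKP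
  have hrate' := rate_of_printShaped (ν := ν) hKP hrate
  have eμ := rateLetter_printShaped ν ((D : ℝ) + 1) a'' εbar αbar cQ ω
  have h := torus_termSize_ne9_and_fadingMemory_of_linSizeDischargers_cpieceGain Γ P ρ h0 hAdm hres h0P hloc hsrc hA hPiece hLev
    hKp hO1 hgain hcQ hω hfac hlast hρ hΨ hexpl hbase (fun j => by rw [aStar_envelope]; exact hNsucc j) hNnn hbox hpre hc hpt
    (lip := fun _ => αbar * 2 ^ (ν + 1 + 2 ^ ν)) (lipbar := αbar * 2 ^ (ν + 1 + 2 ^ ν))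
    (fun _ => mul_pos hαbar hP0) (fun _ => le_rfl) hint₀ hmeet hα4 ha
    (fun k => mul_le_mul_of_nonneg_right (hα4b k) hP0.le) hlin hdomconn hdominj hXconn hcmp hε' hdecayLin hA0 ha'' hrate'
    hsmall hℓ hlam
  rw [eμ] at h
  exact h

end PieceForm

end Summit.QuantumFields.BalabanUV.T4Continuum.NE9LinSizeEndPrintShaped

end
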